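import Summits.BirchSwinnertonDyer.Rank1Residual.O5.CharTwistThreeIsometry
import HarnessLib

/-!
# O5/N10 (`p² ∣ N`): the twist by `(·/p)` — algebra, and the level `Γ₀(N) ∩ Γ₁(p)` it normalises

HONEST FRAMING (cell `b2b-bsdres`, run/shared/lean/b2b/bsd-rank1-residual/, verbatim in every
file): the goal of the cell is to DELETE the COMBINATION-SHAPED residual classes of the
Birch–Swinnerton-Dyer formula for ALL analytic-rank `≤ 1` elliptic curves over `ℚ` — assembled
STRICTLY from published theorems — so that the rank-`≤ 1` remainder becomes exactly the
CONSTRUCTION-SHAPED classes, which are TYPED, NOT attempted. This is not "finishing BSD". Lane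
CLASS-CLOSURE, team o5; o5-r2 GEN 7 (G7-2)/N2 'TWIN' and cc-typer-5's node `O5.CongruenceNumberTwin`
(ALL odd `p`); prover seat `b2b-bsdres-x11b3-p5` (gen. 7, cross-cell pool). THEOREMS ONLY (no
definition, no named fact, no `sorry`); nothing booked; no RESIDUAL-MAP mark / label / count moved.
A TOOL file (part 1 of the general-`p` twin isometry); nothing about any curve.

For a prime `p` with `p² ∣ N` the translation `[1, u/p; 0, 1]` does not normalise `Γ₀(N)` (unless
`p ∣ 24`, the case of `O5/CharTwistThreeIsometry.lean`) but it DOES normalise the finite-index subgroup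
`Λ := Γ₀(N) ∩ Γ₁(p)`: for `γ = (a b; c d)` with `p² ∣ c`, `a ≡ d ≡ 1 (p)`,
`[1,u/p;0,1] γ [1,u/p;0,1]⁻¹ = (a + uc/p, *; c, d − uc/p) ∈ Λ`. Contents: §1 the primitive quadratic
character `χ` mod `p` (`χ(n) = 0` for `p ∣ n`, `χ(n)² = 1` else, integrality, `χ ≠ 1`, and the sums
`∑_u χ(u)χ(u+w) = −1` (`w ≠ 0`, via the Jacobi sum `J(χ, χ⁻¹) = −χ(−1)`), `= p − 1` (`w = 0`));
§2 the twist `R f := charTwist N _ _ _ f` (`aₙ(R f) = χ(n)aₙ(f)`): additive, homogeneous, `p`-depleted,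
an involution on `p`-depleted forms, integrality-preserving; §3 the level `Λ`: `1` is a strict period,
`[1, u/p; 0, 1]` normalises `Λ`, translates exist on `Λ`, their `q`-expansions, adjointness
`⟨T_u F, T_v X⟩_Λ = ⟨F, T_{v−u} X⟩_Λ` (Diamond–Shurman Prop. 5.5.2(a)), integer translates trivial.

References: [Shimura1971] Prop. 3.64; [DiamondShurman2005] Prop. 5.5.2(a); [AgasheRibetStein2012] §2.1.
-/

noncomputable section

open scoped MatrixGroups ModularForm ComplexConjugate Real Pointwise

open Matrix.SpecialLinearGroup Matrix.GeneralLinearGroup UpperHalfPlane Complex ConjAct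
  CongruenceSubgroup Literature.NumberTheory.EllipticCurves.ModularForms
  Literature.NumberTheory.Automorphic

namespace Summit.BirchSwinnertonDyer.Rank1Residual.O5.PrimeTwist

/-! ### §1 The quadratic primitive character mod `p` -/

section Chi

variable {p : ℕ} [hp : Fact p.Prime] {χ : DirichletCharacter ℂ p}

/-- `χ(n) = 0` for `p ∣ n`. [folklore] -/
theorem chi_natCast_eq_zero (χ : DirichletCharacter ℂ p) {n : ℕ} (hn : p ∣ n) :
    χ (n : ZMod p) = 0 := by
  rw [(ZMod.natCast_eq_zero_iff n p).mpr hn]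
  exact χ.map_nonunit not_isUnit_zero

/-- `χ(n)² = 1` for `p ∤ n` and `χ` quadratic. [folklore] -/
theorem chi_natCast_sq (hχ : χ.IsQuadratic) {n : ℕ} (hn : ¬ p ∣ n) : χ (n : ZMod p) ^ 2 = 1 := by
  refine apply_sq_eq_one_of_isQuadratic hχ ?_
  rw [isUnit_iff_ne_zero, ne_eq, ZMod.natCast_eq_zero_iff]
  exact hn

/-- `χ(a)² = 1` for `a ≠ 0` and `χ` quadratic. [folklore] -/
theorem chi_sq_of_ne_zero (hχ : χ.IsQuadratic) {a : ZMod p} (ha : a ≠ 0) : χ a ^ 2 = 1 :=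
  apply_sq_eq_one_of_isQuadratic hχ (isUnit_iff_ne_zero.mpr ha)
omit hp in
/-- The values of a quadratic character are integers. [folklore] -/
theorem exists_intCast_eq_chi (hχ : χ.IsQuadratic) (a : ZMod p) : ∃ z : ℤ, (z : ℂ) = χ a := by
  rcases hχ a with h | h | h
  · exact ⟨0, by rw [h, Int.cast_zero]⟩
  · exact ⟨1, by rw [h, Int.cast_one]⟩
  · exact ⟨-1, by rw [h, Int.cast_neg, Int.cast_one]⟩

/-- A primitive character mod a prime is non-trivial (the trivial character has conductor `1`).
[folklore] -/
theorem chi_ne_one (hprim : χ.IsPrimitive) : χ ≠ 1 := by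
  intro h
  have hc := hprim
  rw [DirichletCharacter.IsPrimitive, h, DirichletCharacter.conductor_one] at hc
  exact hp.out.one_lt.ne hc

/-- **`∑_u χ(u) χ(u + w) = −1` for `w ≠ 0`** (`χ` quadratic, primitive mod the prime `p`):
substituting `u = −w x` turns the sum into `χ(−w)χ(w) · J(χ, χ)` with the Jacobi sum
`J(χ, χ⁻¹) = −χ(−1)` (Mathlib `jacobiSum_nontrivial_inv`), and `χ(−w)χ(w)χ(−1) = χ(w)²χ(−1)² = 1`.
[folklore] -/
theorem sum_chi_mul_chi_add_of_ne_zero (hχ : χ.IsQuadratic) (hprim : χ.IsPrimitive) {w : ZMod p}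
    (hw : w ≠ 0) : ∑ u : ZMod p, χ u * χ (u + w) = -1 := by
  have hJ : jacobiSum χ χ = -χ (-1) := by
    have h := jacobiSum_nontrivial_inv (chi_ne_one hprim)
    rwa [hχ.inv] at h
  have hw' : -w ≠ 0 := neg_ne_zero.mpr hw
  -- substitute `u = (-w) * x`
  have hsub : ∑ u : ZMod p, χ u * χ (u + w) = ∑ x : ZMod p, χ (-w * x) * χ (-w * x + w) :=
    (Fintype.sum_equiv (Equiv.mulLeft₀ (-w) hw') _ _ fun x ↦ rfl).symm
  rw [hsub]
  have hterm : ∀ x : ZMod p, χ (-w * x) * χ (-w * x + w) = χ (-w) * χ w * (χ x * χ (1 - x)) := by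
    intro x
    rw [show -w * x + w = w * (1 - x) by ring, map_mul, map_mul]
    ring
  simp_rw [hterm]
  rw [← Finset.mul_sum]
  change χ (-w) * χ w * jacobiSum χ χ = -1
  rw [hJ, show (-w : ZMod p) = (-1) * w by ring, map_mul]
  have h1 : χ (-1) ^ 2 = 1 := chi_sq_of_ne_zero hχ (by rw [ne_eq, neg_eq_zero]; exact one_ne_zero)
  have h2 : χ w ^ 2 = 1 := chi_sq_of_ne_zero hχ hw
  linear_combination (-(χ w ^ 2)) * h1 - h2

/-- **`∑_u χ(u)² = p − 1`** (`χ(u)² = 1` for the `p − 1` units, `χ(0) = 0`). [folklore] -/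
theorem sum_chi_mul_chi (hχ : χ.IsQuadratic) : ∑ u : ZMod p, χ u * χ u = (p : ℂ) - 1 := by
  have hterm : ∀ u : ZMod p, χ u * χ u = if u = 0 then 0 else 1 := by
    intro u
    split_ifs with h
    · rw [h, χ.map_nonunit not_isUnit_zero, mul_zero]
    · rw [← sq, chi_sq_of_ne_zero hχ h]
  simp_rw [hterm]
  rw [Finset.sum_ite, Finset.sum_const_zero, zero_add, Finset.sum_const, nsmul_eq_mul, mul_one,
    Finset.filter_ne' Finset.univ (0 : ZMod p), Finset.card_erase_of_mem (Finset.mem_univ _),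
    Finset.card_univ, ZMod.card, Nat.cast_sub hp.out.one_le, Nat.cast_one]

end Chi

/-! ### §2 The twist by `(·/p)` at level `p² ∣ N`: `q`-expansion algebra -/

section Twist

variable {N p : ℕ} [NeZero N] [hp : Fact p.Prime] {k : ℤ} (hpN : p ^ 2 ∣ N)
  {χ : DirichletCharacter ℂ p} (hχ : χ.IsQuadratic)

/-- The twist is additive (coefficientwise). [folklore] -/
theorem charTwist_add (hprim : χ.IsPrimitive) (f g : CuspForm (Gamma0 N) k) :
    charTwist N dvd_rfl hpN hχ (f + g) = charTwist N dvd_rfl hpN hχ f + charTwist N dvd_rfl hpN hχ g := by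
  refine eq_of_forall_cuspCoeff_eq_gamma0 fun n ↦ ?_
  rw [cuspCoeff_add_form (one_mem_strictPeriods_coe_gamma0 N), cuspCoeff_charTwist N _ hpN hχ hprim,
    cuspCoeff_charTwist N _ hpN hχ hprim, cuspCoeff_charTwist N _ hpN hχ hprim,
    cuspCoeff_add_form (one_mem_strictPeriods_coe_gamma0 N), mul_add]

/-- The twist is `ℂ`-homogeneous. [folklore] -/
theorem charTwist_smul (hprim : χ.IsPrimitive) (c : ℂ) (f : CuspForm (Gamma0 N) k) :
    charTwist N dvd_rfl hpN hχ (c • f) = c • charTwist N dvd_rfl hpN hχ f := by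
  refine eq_of_forall_cuspCoeff_eq_gamma0 fun n ↦ ?_
  rw [cuspCoeff_smul, cuspCoeff_charTwist N _ hpN hχ hprim, cuspCoeff_charTwist N _ hpN hχ hprim,
    cuspCoeff_smul, mul_left_comm]

/-- The twist is `ℤ`-homogeneous. [folklore] -/
theorem charTwist_zsmul (hprim : χ.IsPrimitive) (z : ℤ) (f : CuspForm (Gamma0 N) k) :
    charTwist N dvd_rfl hpN hχ (z • f) = z • charTwist N dvd_rfl hpN hχ f := by
  rw [← Int.cast_smul_eq_zsmul ℂ z f, charTwist_smul hpN hχ hprim, Int.cast_smul_eq_zsmul]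

/-- The twist is `p`-DEPLETED: `aₙ(R f) = 0` for `p ∣ n`. [folklore] -/
theorem cuspCoeff_charTwist_eq_zero_of_dvd (hprim : χ.IsPrimitive) (f : CuspForm (Gamma0 N) k) {n : ℕ}
    (hn : p ∣ n) : cuspCoeff (charTwist N dvd_rfl hpN hχ f) n = 0 := by
  rw [cuspCoeff_charTwist N _ hpN hχ hprim, chi_natCast_eq_zero χ hn, zero_mul]

/-- **The twist is an INVOLUTION on `p`-depleted forms**: `R(R f) = f`. [folklore] -/
theorem charTwist_charTwist (hprim : χ.IsPrimitive) {f : CuspForm (Gamma0 N) k}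
    (hf : ∀ n, p ∣ n → cuspCoeff f n = 0) :
    charTwist N dvd_rfl hpN hχ (charTwist N dvd_rfl hpN hχ f) = f := by
  refine eq_of_forall_cuspCoeff_eq_gamma0 fun n ↦ ?_
  rw [cuspCoeff_charTwist N _ hpN hχ hprim, cuspCoeff_charTwist N _ hpN hχ hprim, ← mul_assoc, ← sq]
  by_cases hn : p ∣ n
  · rw [hf n hn, mul_zero]
  · rw [chi_natCast_sq hχ hn, one_mul]

/-- The twist maps `S_k(Γ₀(N); ℤ)` into itself (`χ(n) ∈ {0, ±1}`). [folklore] -/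
theorem charTwist_mem_integralCuspForms0 (hprim : χ.IsPrimitive) {f : CuspForm (Gamma0 N) k}
    (hf : f ∈ integralCuspForms0 N k) : charTwist N dvd_rfl hpN hχ f ∈ integralCuspForms0 N k := by
  intro n
  obtain ⟨a, ha⟩ := hf n
  obtain ⟨z, hz⟩ := exists_intCast_eq_chi hχ (n : ZMod p)
  exact ⟨z * a, by rw [cuspCoeff_charTwist N _ hpN hχ hprim, Int.cast_mul, hz, ha]⟩

end Twist

/-! ### §3 The level `Λ = Γ₀(N) ∩ Γ₁(p)` and translates by `u/p` -/

section Level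

variable {N p : ℕ} [NeZero N] [hp : Fact p.Prime] {k : ℤ}

omit [NeZero N] hp in
/-- `Γ₀(N) ∩ Γ₁(p) ≤ Γ₀(N)` (images in `GL(2, ℝ)`). [folklore] -/
theorem level_le :
    (((Gamma0 N ⊓ Gamma1 p : Subgroup SL(2, ℤ)) : Subgroup (GL (Fin 2) ℝ))) ≤
      ((Gamma0 N : Subgroup SL(2, ℤ)) : Subgroup (GL (Fin 2) ℝ)) :=
  Subgroup.map_mono inf_le_left

omit [NeZero N] in
/-- `1` is a strict period of `Γ₀(N) ∩ Γ₁(p)` (it contains `T`). [folklore] -/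
theorem one_mem_strictPeriods_level :
    (1 : ℝ) ∈ (((Gamma0 N ⊓ Gamma1 p : Subgroup SL(2, ℤ)) : Subgroup (GL (Fin 2) ℝ))).strictPeriods := by
  have hT : ModularGroup.T ∈ (Gamma0 N ⊓ Gamma1 p : Subgroup SL(2, ℤ)) := by
    refine Subgroup.mem_inf.mpr ⟨?_, ?_⟩
    · simpa using Literature.NumberTheory.EllipticCurves.ModularForms.T_zpow_mem_Gamma0 N 1
    · rw [Gamma1_mem, ModularGroup.coe_T]
      simp
  rw [Subgroup.strictPeriods_eq_zmultiples_one_of_T_mem hT]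
  exact AddSubgroup.mem_zmultiples 1

omit [NeZero N] in
/-- **Conjugating `Λ = Γ₀(N) ∩ Γ₁(p)` by `[1, u/p; 0, 1]` (`p² ∣ N`)**: for `γ = (a b; c d) ∈ Λ`
(`p² ∣ N ∣ c`, `a ≡ d ≡ 1 (p)`), `[1, u/p; 0, 1] γ [1, u/p; 0, 1]⁻¹ = (a + u c/p, *; c, d − u c/p) ∈ Λ`.
[folklore] -/
theorem translGL_mul_mul_inv_mem_level (hpN : p ^ 2 ∣ N) (u : ℤ) {x : GL (Fin 2) ℝ}
    (hx : x ∈ (((Gamma0 N ⊓ Gamma1 p : Subgroup SL(2, ℤ)) : Subgroup (GL (Fin 2) ℝ)))) :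
    glCast (translGL ((u : ℚ) / p) : GL (Fin 2) ℚ) * x *
        (glCast (translGL ((u : ℚ) / p) : GL (Fin 2) ℚ))⁻¹ ∈
      (((Gamma0 N ⊓ Gamma1 p : Subgroup SL(2, ℤ)) : Subgroup (GL (Fin 2) ℝ))) := by
  haveI : NeZero p := ⟨hp.out.ne_zero⟩
  obtain ⟨γ, hγ, rfl⟩ := hx
  obtain ⟨hγ0, hγ1⟩ := Subgroup.mem_inf.mp hγ
  rw [Gamma0_mem] at hγ0
  rw [Gamma1_mem] at hγ1
  -- `c = p² c₂`, `a = 1 + p s`, `d = 1 + p t`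
  have hcN : (N : ℤ) ∣ γ 1 0 := (ZMod.intCast_zmod_eq_zero_iff_dvd _ _).mp hγ0
  have hc : ((p : ℤ) ^ 2) ∣ γ 1 0 := (by exact_mod_cast hpN : ((p : ℤ) ^ 2) ∣ (N : ℤ)).trans hcN
  obtain ⟨c₂, hc₂⟩ := hc
  have ha : ((p : ℕ) : ℤ) ∣ γ 0 0 - 1 := by
    rw [← ZMod.intCast_zmod_eq_zero_iff_dvd, Int.cast_sub, Int.cast_one, hγ1.1, sub_self]
  have hd : ((p : ℕ) : ℤ) ∣ γ 1 1 - 1 := by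
    rw [← ZMod.intCast_zmod_eq_zero_iff_dvd, Int.cast_sub, Int.cast_one, hγ1.2.1, sub_self]
  obtain ⟨s, hs⟩ := ha
  obtain ⟨t, ht⟩ := hd
  set a := γ 0 0 with hadef
  set b := γ 0 1 with hbdef
  set c := γ 1 0 with hcdef
  set d := γ 1 1 with hddef
  have hp0 : (p : ℝ) ≠ 0 := by exact_mod_cast hp.out.ne_zero
  have hdet : a * d - b * (p ^ 2 * c₂) = 1 := by
    have := det_entries γ
    rw [← hc₂]
    linear_combination this
  let A : Matrix (Fin 2) (Fin 2) ℤ :=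
    !![a + u * p * c₂, b + u * (t - s) - u ^ 2 * c₂; p ^ 2 * c₂, d - u * p * c₂]
  have hda : d - a = p * (t - s) := by linear_combination ht - hs
  have hA : A.det = 1 := by
    rw [Matrix.det_fin_two_of]
    linear_combination hdet + u * p * c₂ * hda
  refine ⟨⟨A, hA⟩, Subgroup.mem_inf.mpr ⟨?_, ?_⟩, ?_⟩
  · -- `∈ Γ₀(N)`
    rw [Gamma0_mem]
    change ((A 1 0 : ℤ) : ZMod N) = 0
    simp only [A, Matrix.of_apply, Matrix.cons_val', Matrix.cons_val_zero, Matrix.cons_val_one,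
      Matrix.cons_val_fin_one]
    rw [← hc₂]; exact hγ0
  · -- `∈ Γ₁(p)`
    rw [Gamma1_mem]
    change ((A 0 0 : ℤ) : ZMod p) = 1 ∧ ((A 1 1 : ℤ) : ZMod p) = 1 ∧ ((A 1 0 : ℤ) : ZMod p) = 0
    simp only [A, Matrix.of_apply, Matrix.cons_val', Matrix.cons_val_zero, Matrix.cons_val_one,
      Matrix.cons_val_fin_one]
    have ha' : a = p * s + 1 := by linear_combination hs
    have hd' : d = p * t + 1 := by linear_combination ht
    refine ⟨?_, ?_, ?_⟩
    · rw [ha']; push_cast; simp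
    · rw [hd']; push_cast; simp
    · push_cast; simp
  · -- the matrix identity `[1, u/p; 0, 1] γ = A [1, u/p; 0, 1]`
    have hγ : ((mapGL ℝ γ : GL (Fin 2) ℝ) : Matrix (Fin 2) (Fin 2) ℝ) =
        !![(a : ℝ), (b : ℝ); (p : ℝ) ^ 2 * c₂, (d : ℝ)] := by
      rw [val_mapGL']
      ext i j
      fin_cases i <;> fin_cases j <;> simp [← hadef, ← hbdef, ← hcdef, ← hddef, hc₂]
    have hγ'' : ((mapGL ℝ (⟨A, hA⟩ : SL(2, ℤ)) : GL (Fin 2) ℝ) : Matrix (Fin 2) (Fin 2) ℝ) =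
        !![(a : ℝ) + u * p * c₂, (b : ℝ) + u * (t - s) - u ^ 2 * c₂;
          (p : ℝ) ^ 2 * c₂, (d : ℝ) - u * p * c₂] := by
      rw [val_mapGL']
      ext i j
      fin_cases i <;> fin_cases j <;> simp [A]
    have htr : (d : ℝ) - a = p * (t - s) := by exact_mod_cast hda
    have key : glCast (translGL ((u : ℚ) / p) : GL (Fin 2) ℚ) * (mapGL ℝ γ : GL (Fin 2) ℝ) =
        (mapGL ℝ (⟨A, hA⟩ : SL(2, ℤ)) : GL (Fin 2) ℝ) * glCast (translGL ((u : ℚ) / p) : GL (Fin 2) ℚ) := by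
      refine Units.ext ?_
      simp only [Matrix.GeneralLinearGroup.coe_mul, coe_glCast_translGL, hγ, hγ'']
      push_cast
      ext i j
      fin_cases i <;> fin_cases j
      · simp [Matrix.mul_apply, Fin.sum_univ_two]
        field_simp
      · simp [Matrix.mul_apply, Fin.sum_univ_two]
        field_simp
        linear_combination (u : ℝ) * htr
      · simp [Matrix.mul_apply, Fin.sum_univ_two]
      · simp [Matrix.mul_apply, Fin.sum_univ_two]
        field_simp
        ring
    rw [key, mul_inv_cancel_right]

omit [NeZero N] in
/-- **`[1, u/p; 0, 1]` NORMALISES `Λ = Γ₀(N) ∩ Γ₁(p)`** (`p² ∣ N`):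
`[1, u/p; 0, 1]⁻¹ Λ [1, u/p; 0, 1] = Λ` as subgroups of `GL(2, ℝ)`. [folklore] -/
theorem conj_translGL_level_eq (hpN : p ^ 2 ∣ N) (u : ℤ) :
    toConjAct (glCast (translGL ((u : ℚ) / p) : GL (Fin 2) ℚ))⁻¹ •
        (((Gamma0 N ⊓ Gamma1 p : Subgroup SL(2, ℤ)) : Subgroup (GL (Fin 2) ℝ))) =
      (((Gamma0 N ⊓ Gamma1 p : Subgroup SL(2, ℤ)) : Subgroup (GL (Fin 2) ℝ))) := by
  set T : GL (Fin 2) ℝ := glCast (translGL ((u : ℚ) / p) : GL (Fin 2) ℚ) with hT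
  have hTneg : glCast (translGL (((-u : ℤ) : ℚ) / p) : GL (Fin 2) ℚ) = T⁻¹ := by
    rw [hT, ← glCast_translGL_neg]
    congr 2
    push_cast
    ring
  ext x
  rw [Subgroup.mem_pointwise_smul_iff_inv_smul_mem, toConjAct_inv, inv_inv, toConjAct_smul]
  constructor
  · intro h
    have h' := translGL_mul_mul_inv_mem_level hpN (-u) h
    rwa [hTneg, inv_inv, ← mul_assoc, ← mul_assoc, inv_mul_cancel, one_mul, mul_assoc,
      inv_mul_cancel, mul_one] at h'
  · exact translGL_mul_mul_inv_mem_level hpN u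

/-- **Translates exist on `Λ`**: for `X ∈ S_k(Λ)` and `u ∈ ℤ` some `Y ∈ S_k(Λ)` has underlying
function `X ∣[k] [1, u/p; 0, 1]`. [cite: DiamondShurman2005, Prop. 5.5.2(a)] -/
theorem exists_translate_level (hpN : p ^ 2 ∣ N)
    (X : CuspForm (((Gamma0 N ⊓ Gamma1 p : Subgroup SL(2, ℤ)) : Subgroup (GL (Fin 2) ℝ))) k)
    (u : ℤ) :
    ∃ Y : CuspForm (((Gamma0 N ⊓ Gamma1 p : Subgroup SL(2, ℤ)) : Subgroup (GL (Fin 2) ℝ))) k,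
      (⇑Y : ℍ → ℂ) = (⇑X : ℍ → ℂ) ∣[k] glCast (translGL ((u : ℚ) / p) : GL (Fin 2) ℚ) := by
  refine ⟨cuspFormOfInvariant (CuspForm.translate X (glCast (translGL ((u : ℚ) / p) : GL (Fin 2) ℚ)))
    fun γ hγ ↦ ?_, rfl⟩
  rw [coe_cuspForm_translate]
  have hmem := translGL_mul_mul_inv_mem_level hpN u hγ
  have h := SlashInvariantFormClass.slash_action_eq X _ hmem
  calc ((⇑X : ℍ → ℂ) ∣[k] glCast (translGL ((u : ℚ) / p) : GL (Fin 2) ℚ)) ∣[k] γ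
      = ((⇑X : ℍ → ℂ) ∣[k] (glCast (translGL ((u : ℚ) / p) : GL (Fin 2) ℚ) * γ *
          (glCast (translGL ((u : ℚ) / p) : GL (Fin 2) ℚ))⁻¹)) ∣[k]
          glCast (translGL ((u : ℚ) / p) : GL (Fin 2) ℚ) := by
        rw [← SlashAction.slash_mul, ← SlashAction.slash_mul, inv_mul_cancel_right]
    _ = (⇑X : ℍ → ℂ) ∣[k] glCast (translGL ((u : ℚ) / p) : GL (Fin 2) ℚ) := by rw [h]

omit [NeZero N] in
/-- **`q`-expansion of a translate on `Λ`**: if `⇑Y = x ∣[k] [1, q; 0, 1]` for `x ∈ S_k(Γ₀(N))` and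
`Y ∈ S_k(Λ)`, then `aₙ(Y) = e^{2πi q n} aₙ(x)` (`1` is a strict period of `Λ`). [folklore] -/
theorem cuspCoeff_of_coe_eq_slash_translGL {x : CuspForm (Gamma0 N) k}
    {Y : CuspForm (((Gamma0 N ⊓ Gamma1 p : Subgroup SL(2, ℤ)) : Subgroup (GL (Fin 2) ℝ))) k} {q : ℚ}
    (hY : (⇑Y : ℍ → ℂ) = (⇑x : ℍ → ℂ) ∣[k] glCast (translGL q : GL (Fin 2) ℚ)) (n : ℕ) :
    cuspCoeff Y n = Complex.exp (2 * π * Complex.I * q * n) * cuspCoeff x n := by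
  have hΓ := one_mem_strictPeriods_level (N := N) (p := p)
  have hsum : ∀ τ : ℍ, HasSum (fun m : ℕ ↦ (Complex.exp (2 * π * Complex.I * q * m) * cuspCoeff x m) •
      Function.Periodic.qParam 1 (τ : ℂ) ^ m) (Y τ) := by
    intro τ
    have h := hasSum_cuspCoeff_exp x (((q : ℝ)) +ᵥ τ)
    rw [show Y τ = x (((q : ℝ)) +ᵥ τ) by rw [← slash_translGL_apply (⇑x) k q τ, ← hY]]
    refine h.congr_fun fun m ↦ ?_
    have key : Complex.exp (2 * π * Complex.I * q * m) * Function.Periodic.qParam 1 (τ : ℂ) ^ m =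
        Complex.exp (2 * π * Complex.I * m * ((((q : ℝ)) +ᵥ τ : ℍ) : ℂ)) := by
      rw [Function.Periodic.qParam, ← Complex.exp_nat_mul, ← Complex.exp_add, UpperHalfPlane.coe_vadd]
      congr 1
      push_cast
      ring
    rw [smul_eq_mul, mul_right_comm, key, mul_comm]
  rw [cuspCoeff, ← ModularFormClass.qExpansion_coeff_unique one_pos hΓ hsum n]

/-- **Adjointness of translates on `Λ`** (Diamond–Shurman Prop. 5.5.2(a) with `α = [1, u/p; 0, 1]`,
which normalises `Λ`): `⇑F = f ∣ [1,u/p;0,1]`, `⇑X = x ∣ [1,v/p;0,1]`, `⇑Y = x ∣ [1,w/p;0,1]`,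
`u + w = v` ⇒ `⟨F, X⟩_Λ = ⟨f, Y⟩_Λ`. [cite: DiamondShurman2005, Prop. 5.5.2(a)] -/
theorem peterssonProduct_translate_translate (hpN : p ^ 2 ∣ N)
    {f x F X Y : CuspForm (((Gamma0 N ⊓ Gamma1 p : Subgroup SL(2, ℤ)) : Subgroup (GL (Fin 2) ℝ))) k}
    {u v w : ℤ} (huvw : u + w = v)
    (hF : (⇑F : ℍ → ℂ) = (⇑f : ℍ → ℂ) ∣[k] glCast (translGL ((u : ℚ) / p) : GL (Fin 2) ℚ))
    (hX : (⇑X : ℍ → ℂ) = (⇑x : ℍ → ℂ) ∣[k] glCast (translGL ((v : ℚ) / p) : GL (Fin 2) ℚ))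
    (hY : (⇑Y : ℍ → ℂ) = (⇑x : ℍ → ℂ) ∣[k] glCast (translGL ((w : ℚ) / p) : GL (Fin 2) ℚ)) :
    peterssonProduct (((Gamma0 N ⊓ Gamma1 p : Subgroup SL(2, ℤ)) : Subgroup (GL (Fin 2) ℝ))) k F X =
      peterssonProduct (((Gamma0 N ⊓ Gamma1 p : Subgroup SL(2, ℤ)) : Subgroup (GL (Fin 2) ℝ))) k f Y := by
  subst huvw
  have hSL : (((Gamma0 N ⊓ Gamma1 p : Subgroup SL(2, ℤ)) : Subgroup (GL (Fin 2) ℝ))) ≤ 𝒮ℒ :=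
    Subgroup.map_le_range _ _
  have hYX : (⇑Y : ℍ → ℂ) = (⇑X : ℍ → ℂ) ∣[k] glCast (translGL (-((u : ℚ) / p)) : GL (Fin 2) ℚ) := by
    rw [hY, hX, ← SlashAction.slash_mul, glCast_translGL_mul_glCast_translGL]
    congr 3
    push_cast
    ring
  have h := peterssonProduct_translate_adjoint
    (((Gamma0 N ⊓ Gamma1 p : Subgroup SL(2, ℤ)) : Subgroup (GL (Fin 2) ℝ)))
    hSL k (translGL ((u : ℚ) / p)) (translGL (-((u : ℚ) / p))) (coe_translGL_neg_eq_adjugate _)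
    (((Gamma0 N ⊓ Gamma1 p : Subgroup SL(2, ℤ)) : Subgroup (GL (Fin 2) ℝ)))
    (conj_translGL_level_eq hpN u).symm hSL f X F Y hF hYX
  rw [peterssonProduct_conj_symm_holds _ k X F, h, peterssonProduct_conj_symm_holds _ k f Y,
    Complex.conj_conj]

omit [NeZero N] in
/-- **Integer translates of a `Γ₀(N)`-form are trivial**: `x ∣[k] [1, q + j; 0, 1] = x ∣[k] [1, q; 0, 1]`
for `j ∈ ℤ` (`[1, j; 0, 1] ∈ Γ₀(N)`). [folklore] -/
theorem slash_translGL_add_intCast (x : CuspForm (Gamma0 N) k) (q : ℚ) (j : ℤ) :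
    (⇑x : ℍ → ℂ) ∣[k] glCast (translGL (q + j) : GL (Fin 2) ℚ) =
      (⇑x : ℍ → ℂ) ∣[k] glCast (translGL q : GL (Fin 2) ℚ) := by
  rw [show q + (j : ℚ) = (j : ℚ) + q by ring, ← glCast_translGL_mul_glCast_translGL,
    SlashAction.slash_mul, slash_translGL_intCast]

end Level

end Summit.BirchSwinnertonDyer.Rank1Residual.O5.PrimeTwist
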